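import Mathlib
import Literature.MathematicalPhysics.QuantumFieldTheory.Dimock2015.AnalyticLipschitz
import Literature.MathematicalPhysics.QuantumFieldTheory.Balaban1983to89.T4OutputRate
import Literature.MathematicalPhysics.QuantumFieldTheory.Balaban1983to89.T4BetaMemory

/-!
# T4InputCauchyRate — the INPUT-INTERPOLATION CAUCHY RATE: block-by-block Cauchy estimates for one analytic functional
# read at two input data points, and the kernel reduction of the η-rate shape `T4OutputRate.NE5` to a recursive
# block budget (cell `pub-balaban`, T⁴-continuum fan-out, node U3 / spine estimate NE5, prover seat P1 = "cluster-expansion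
# derivative bound: differentiate the convergent expansion in its inputs and bound term-wise (analyticity ⇒ Cauchy)")

HONEST FRAMING.  The cell's T4 target is rung (B)+1 (existence AND uniqueness of the ε → 0 limit of Bałaban's unit-scale
expectations on a FIXED finite torus T⁴); NOT infinite volume, NOT a mass gap, NOT the Clay problem.  The conditionals of
the spine (BetaPertH, (B), (B^μ)) are untouched by this module and stay explicit wherever the spine composes (`T4OutputRate`
docstring; T4-DAG §2).  NOTHING printed in the audited papers is asserted here: every `def … : Prop` below is a HYPOTHESIS
SHAPE over the ABSTRACT carriers of `T4OutputRate` (to be ASSUMED by consumers, never cited as a fact), and every `theorem`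
is kernel-checked complex analysis / real bookkeeping about the shapes.  The estimate NE5 itself is NOT PRINTED anywhere in
[Balaban1987RG1], [Balaban1988RG2Cluster], [Balaban1988Convergent] (cell GAPS G-t4-U3-1); this module does not change that.
Value = (i) a kernel theorem of several-complex-variables bookkeeping (per-block Cauchy rate on a polydisc) that is the
exact abstract form of the seat's assigned technique, (ii) the kernel-checked reduction "NE5 ⇐ recursive block budget ⇐
per-domain block model", which TYPES the missing inequalities of the technique as named binders; NOT summit progress.

## The technique and its printed mechanism (CONTEXT, [R] = read on the ×2 journal-page renders by this seat; the Bałaban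
## papers are under adjudication and are quoted as context only)

The two runs' one-step outputs `E^{(j),A}(X; g, transport U)` and `E^{(j+1),B}(X; g, U)` (pairing conventions = the DATA of
`T4OutputRate.Carriers`) are produced by ONE cluster-expansion functional — [Balaban1988RG2Cluster] (2.13) p. 14:
*"E^{(k+1)}(X) = Σ_{n≥1} (1/n!) Σ_{(Z₁,…,Zₙ):∪Zᵢ=X} ρᵀ(Z₁,…,Zₙ) H(Z₁)…H(Zₙ)"* — evaluated at two INPUT DATA POINTS (the runs'
propagators / averaging operators / covariances / renormalised old actions).  That the functional depends on its inputs
only through kernel bounds and analyticity is printed: p. 3 (1.5) *"In these equations we can replace the propagators by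
arbitrary operators having the same regularity properties and satisfying the same bounds. Only these bounds were important in
the analysis of Sect. C, E [15], hence the solutions D, A₀ can be considered as functionals of these operators"*; p. 15 *"The
potentials are also analytic functions on the subspace U^c_{k+1}(X, α₀, α₁). The quadratic forms and covariances in H(Z) are
analytic functions on the space of configurations (U, J) … therefore we can restrict them, as analytic functions, to the
above subspace. Thus the activities in (2.13), and the whole sum E^{(k+1)}(X), are analytic functions of (U, J), on the space
U^c_{k+1}(X, α₀, α₁). This is the analyticity statement in the inductive assumptions."*  The paper itself threads COMPLEX
interpolation parameters through operators and potentials and bounds derivatives by the Cauchy formula: p. 5 *"To estimate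
a term in the sum (1.10) we use the Cauchy formula, hence we have to investigate analyticity properties of the functions
E(⋯) with respect to the variables s(Y₀)"*, *"the parameters s(Y₀) are complex valued and satisfy the bound |s(Δ)| ≤ e^{κ₁}"*;
p. 7 (1.22)–(1.24) (the t_□-circle and *"we represent all derivatives by the Cauchy formula"*); p. 15 (2.14)–(2.15) *"We
consider it as an analytic function of (U, J) in the space U^c_{k+1}(X, α₀, α₁), and of the complex parameters σ(Z), τ. …
The general case is handled by a perturbative argument."*; complex covariances sit INSIDE a fixed standard Gaussian
integral, p. 12–13 (2.5)–(2.6) *"= ∫dμ₀(X) G(Z₀, X, C^{(k)}(Z₀), (C^{(k)})^{1/2}, Δ_k), where the last equality is a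
definition of the function G, and the measure dμ₀"*, with the non-symmetric errors controlled by (2.16)–(2.17) p. 16.
The HISTORY inputs (old actions E^{(j)}, j ≤ k) enter through V′_k of Lemma 1 p. 9 (1.33)–(1.36) and are damped by
irrelevance: p. 7 (1.24) factor (Lʲη)⁵, p. 8 *"This yields (6L)⁴Lʲη, and the sum over j is bounded by 2(6L)⁴"*;
[Balaban1987RG1] p. 280 (3.54) (fifth-order Taylor remainder by the Cauchy formula in σ, *"Because |B| < O(1)Lʲη, e.g.
|B| < α₁Lʲη, hence we have the required bound."*) and p. 258 (0.29)–(0.30) (net factor (Lʲη)^α after the volume sums).  The PRINTED MODEL of an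
η-rate obtained by replacing inputs one at a time is [King1986] p. 665 (PUBLISHED, outside the audited series, U(1) Higgs
d = 2, 3): *"If we replace such a propagator in E_φ^{(k+n)}(H̃), the error is the same graph with a difference or
propagators on one line. Using the method presented, this error is bounded, and Proposition 3.8 gives the desired factor
L^{−γk}."* and Prop. 3.9 (3.73) (two-spacing propagator discrepancy
`|G^{η′}_{(j)}(x′, y′) − G^η_{(j)}(x, y)|, |∂^{η′}_μ G^{η′}_{(j)}(x′, y′) − ∂^η_μ G^η_{(j)}(x, y)| ≤ CL^{−γk}{(Lʲη)^{2−d−γ},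
(Lʲη)^{1−d−γ}} exp[−δ₀(Lʲη)^{−1}|x − y|]`).
The present module is the NON-PERTURBATIVE form of King's "one line at a time": the inputs are grouped in BLOCKS
(coordinates of a product of complex normed spaces), the two data points are joined by the staircase path that swaps one
block at a time (`mix`), and each swap is bounded by the one-variable Cauchy estimate of
`Dimock2015.norm_sub_le_of_closedBall_subset_half` with THAT BLOCK's analyticity radius.

## What is PROVED (kernel; Mathlib + the three imported modules; no `sorry`, no `axiom`)

§1 `norm_sub_le_sum_of_polydisc` [folklore]: `Φ : (Fin n → P) → F` complex differentiable on the closed polydisc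
`{z | ∀ i, ‖z i − y i‖ ≤ ϱ i}` (`P` any complex normed space, `F` complex Banach) with `‖Φ‖ ≤ M` there, and
`‖x i − y i‖ ≤ ϱ i/2` for all i ⟹ `‖Φ x − Φ y‖ ≤ Σ_i (2M/ϱ i)·‖x i − y i‖` — PER-BLOCK radii (the uniform-margin,
sup-norm case is `Dimock2015.real_params_lipschitz_sum`; the point here is that a block read with sensitivity `w` has
radius `∝ 1/w`, so history blocks of age a get their own factor ω^a).
§2 over `T4OutputRate.Carriers`: `BoundedAtScale` (the scale-j slice of NE5 with constant D), `ne5_iff_boundedAtScale`,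
`RecursiveRate θ ω A b` = "for every scale k and every nonnegative vector D bounding the discrepancies at the scales
j < k, the scale-k discrepancy is ≤ (Aθ^k + Σ_{j<k} bω^{k−j}D_j)·e^{−κd(X)}", and `ne5_of_recursiveRate` [folklore]:
`0 ≤ A, b, ω`, `(1 + b)ω < θ` ⟹ `NE5 … θ (A(θ − ω)/(θ − (1 + b)ω))` (strong induction + `T4BetaMemory.geom_row_sum`; the
constant and the smallness are those of `T4BetaMemory.renewal_geometric`, whose `constMemory_witness` shows that without a
contracting memory NO scale-uniform constant follows); `recursiveRate_mono_rate` (sources at a slower rate θ′ ≥ θ).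
§3 `CauchyBlockStep P … θ ω A b` = the PER-DOMAIN BLOCK MODEL: at every X of scale k (given nonnegative bounds D_j for
j < k) there are m operator blocks and k history blocks in a complex normed space P, one functional Φ analytic and bounded
by M on the polydisc about run B's data, run A's data within half the radii, the real output discrepancy equal to
`Re(Φ p^A − Φ p^B)`, the operator blocks' Cauchy budget `Σ_{i<m} (2M/ϱ_i)‖Δ_i‖ ≤ Aθ^k e^{−κd(X)}` and each history block's
`(2M/ϱ_{m+j})‖Δ_{m+j}‖ ≤ bω^{k−j}D_j e^{−κd(X)}`; `recursiveRate_of_cauchyBlockStep` (by §1 and `Fin.sum_univ_add`) and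
`ne5_of_cauchyBlockStep`.  §4 non-vacuity: a toy carrier on which `CauchyBlockStep` holds and the chain yields a true NE5.

## DICTIONARY block model ↔ printed objects, and the typed MISSING INEQUALITIES (cell record `t4/T4-EST-NE5-P1.md`)

operator block i < m: one species of input operator of the step (H, G̃, H₀ of (1.3)–(1.5) p. 2–3; C^{(k)}, (C^{(k)})^{1/2},
Δ_k of (2.5)–(2.6); the averaging/minimiser data) in its kernel norm ((1.7) p. 3, (2.16) p. 16); `‖Δ_i‖` = the two runs'
discrepancy of that operator at step k — MI-1 = NE3 (node U1b, NOT PRINTED; King (3.73) is the printed model), `ϱ_i` = how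
far the operator may move with B13's bounds intact — MI-2 (the margin: absolute in the [I] spaces p. 263, `g_j`-dependent
(2.28) p. 259 of [III]; `recursiveRate_mono_rate` is the bookkeeping of a geometric loss of radius).  history block j < k:
the scale-j activity family {E^{(j)}(Y; ·)}_Y in the weighted sup norm over the COMPLEX spaces U^c_j(Y, α₀, α₁) (so NE5's
carrier `BgB` must be instantiated with the complex analyticity space for the induction to close — MI-3, a typing remark);
`‖Δ_{m+j}‖ ≤ D_j` = NE5 at scale j; `2M/ϱ_{m+j} ≤ bω^{k−j}e^{−κd}` = the irrelevance damping of the step's sensitivity to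
old actions ((1.24)/(3.54)/(0.29)–(0.30); NOT PRINTED as a statement about discrepancies).  `M` = B13's bound (2.41) p. 21
UNIFORM over the input polydisc — the first non-printed step of the technique (G-ne5p1-1: "B13 §1–2 re-run with one more
complex parameter entering exactly like s, t_□, σ, τ"; every ingredient printed, the statement not).  The coupling g is
COMMON to both runs in NE5 (node U2 supplies the coupling bracket; `T4OutputRate.u3_threeBrackets`) — MI-4.  The smallness
`(1 + b)ω < θ` says: the artifact rate θ delivered by NE3 cannot be faster than the history damping ω allows; any
θ′ ∈ ((1 + b)ω, 1] with θ′ ≥ θ is admissible (`recursiveRate_mono_rate`).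

NOT COVERED.  No functional of Bałaban's is constructed or shown analytic in anything; no operator discrepancy (NE3), no
background rate (NE2), no damping constant is derived; the boundary/R-terms member (B14 (2.40)–(2.42), B16 (1.99)) is the
sibling module `T4BoundaryCarrier`/seat P3 and is not touched; the analytic-in-g branch (p. 266 of [I]) is not used.

CITATION HEADER (lean-in-tree rule 2026-08-18).  T. Bałaban, *Renormalization group approach to lattice gauge field
theories. II. Cluster expansions*, Commun. Math. Phys. **116**, 1–22 (1988) [Balaban1988RG2Cluster] (cell paper B13 = [II];
held `paper:balaban1988-cmp116-rg-ii-cluster`, journal page = PDF page; renders `b2b-balaban-ref1/pages/1988-cmp116-rg-II-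
cluster/…-p001…p022-x2.png`, all read); T. Bałaban, *Renormalization group approach to lattice gauge field theories. I*,
Commun. Math. Phys. **109**, 249–301 (1987) [Balaban1987RG1] (B12 = [I]; journal page = PDF page + 248; renders p010, p014,
p015, p032); T. Bałaban, *Convergent renormalization expansions for lattice gauge theories*, Commun. Math. Phys. **119**,
243–285 (1988) [Balaban1988Convergent] (B14 = [III]; journal page = PDF page + 242; render p017); C. King, *The U(1) Higgs
model. I. The continuum limit*, Commun. Math. Phys. **102**, 649–677 (1986) [King1986] (PUBLISHED, outside the audited
series; render `b2b-balaban-template/king-renders/1986-cmp102-king-u1-higgs-I-p017-x2.png` = p. 665).  What is reproduced: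
NOTHING of the papers' mathematics — only folklore complex analysis (Cauchy estimate along a staircase of one-block moves)
and real bookkeeping; the quotations above are context.  NEW module of unit `b2b-balaban-t4-ne5-p1` (T⁴ fan-out prover P1
for NE5; journal claim T4-U3.E-NE5-PROVE-P1 2026-08-19T06:34:25Z); imports `Dimock2015.AnalyticLipschitz` (the one-block
Cauchy step), `T4OutputRate` (carriers, NE5) and `T4BetaMemory` (`geom_row_sum`) BY NAME and modifies nothing.
-/

noncomputable section

open Metric Set Finset

namespace Literature.MathematicalPhysics.QuantumFieldTheory.Balaban1983to89.T4InputCauchyRate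

open Literature.MathematicalPhysics.QuantumFieldTheory.Dimock2015
open Literature.MathematicalPhysics.QuantumFieldTheory.Balaban1983to89.T4OutputRate
open Literature.MathematicalPhysics.QuantumFieldTheory.Balaban1983to89.T4BetaMemory (geom_row_sum)

/-! ## §1 Per-block Cauchy rate on a polydisc (King's "one line at a time", non-perturbatively) -/

section Blocks

variable {P : Type*}

/-- The staircase path from `y` to `x`: the first `m` blocks taken from `x`, the others from `y` (King's "replace the
propagators one line at a time", [King1986] p. 665). [folklore] -/
def mix {n : ℕ} (x y : Fin n → P) (m : ℕ) : Fin n → P := fun i => if (i : ℕ) < m then x i else y i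

/-- No block swapped: the path starts at `y`. [folklore] -/
theorem mix_zero {n : ℕ} (x y : Fin n → P) : mix x y 0 = y := by
  funext i
  simp [mix]

/-- All blocks swapped: the path ends at `x`. [folklore] -/
theorem mix_self {n : ℕ} (x y : Fin n → P) : mix x y n = x := by
  funext i
  simp [mix, i.isLt]

/-- Before block `m` is swapped it still carries `y m`. [folklore] -/
theorem mix_apply_self {n : ℕ} (x y : Fin n → P) (m : Fin n) : mix x y m m = y m := by
  simp [mix]

/-- One more step of the staircase = updating block `m` to `x m`. [folklore] -/
theorem mix_succ {n : ℕ} (x y : Fin n → P) (m : Fin n) :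
    mix x y ((m : ℕ) + 1) = Function.update (mix x y m) m (x m) := by
  funext i
  by_cases h : i = m
  · subst h
    simp [mix]
  · rw [Function.update_of_ne h]
    have hne : (i : ℕ) ≠ (m : ℕ) := fun e => h (Fin.ext e)
    by_cases hlt : (i : ℕ) < (m : ℕ)
    · have h1 : (i : ℕ) < (m : ℕ) + 1 := Nat.lt_succ_of_lt hlt
      simp [mix, hlt, h1]
    · have h1 : ¬ (i : ℕ) < (m : ℕ) + 1 := by omega
      simp [mix, hlt, h1]

/-- Updating block `m` of the `m`-th staircase point back to `y m` changes nothing. [folklore] -/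
theorem update_mix_self {n : ℕ} (x y : Fin n → P) (m : Fin n) :
    Function.update (mix x y m) m (y m) = mix x y m := by
  rw [← mix_apply_self x y m, Function.update_eq_self]

end Blocks

section Polydisc

variable {P : Type*} [NormedAddCommGroup P]

/-- The closed polydisc about `y` with polyradius `ϱ` in the block space `Fin n → P`: block `i` within `ϱ i` of `y i`.
[folklore] -/
def polydisc {n : ℕ} (y : Fin n → P) (ϱ : Fin n → ℝ) : Set (Fin n → P) :=
  {z | ∀ i, ‖z i - y i‖ ≤ ϱ i}

/-- Membership in the polydisc, blockwise. [folklore] -/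
theorem mem_polydisc {n : ℕ} {y : Fin n → P} {ϱ : Fin n → ℝ} {z : Fin n → P} :
    z ∈ polydisc y ϱ ↔ ∀ i, ‖z i - y i‖ ≤ ϱ i := Iff.rfl

/-- Every staircase point lies in the polydisc about `y` once `x` does (`0 ≤ ϱ`). [folklore] -/
theorem mix_mem_polydisc {n : ℕ} {x y : Fin n → P} {ϱ : Fin n → ℝ} (hϱ : ∀ i, 0 ≤ ϱ i)
    (hx : ∀ i, ‖x i - y i‖ ≤ ϱ i) (m : ℕ) : mix x y m ∈ polydisc y ϱ := by
  intro i
  by_cases h : (i : ℕ) < m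
  · simpa [mix, h] using hx i
  · simpa [mix, h] using hϱ i

/-- Moving one block inside its disc keeps a polydisc point in the polydisc. [folklore] -/
theorem update_mem_polydisc {n : ℕ} {y z : Fin n → P} {ϱ : Fin n → ℝ} (hz : z ∈ polydisc y ϱ) (m : Fin n)
    {w : P} (hw : ‖w - y m‖ ≤ ϱ m) : Function.update z m w ∈ polydisc y ϱ := by
  intro i
  by_cases h : i = m
  · subst h
    simpa using hw
  · rw [Function.update_of_ne h]
    exact hz i

end Polydisc

section CauchyRate

variable {P F : Type*} [NormedAddCommGroup P] [NormedSpace ℂ P] [NormedAddCommGroup F] [NormedSpace ℂ F]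

/-- **PER-BLOCK CAUCHY RATE ON A POLYDISC** (the abstract form of "differentiate the convergent expansion in its inputs and
bound block-wise by Cauchy estimates"; King's "one line at a time" [King1986] p. 665 done non-perturbatively).  Let
`Φ : (Fin n → P) → F` be complex differentiable on the closed polydisc of polyradius `ϱ` (all `ϱ i > 0`) about `y`, with
`‖Φ‖ ≤ M` there, and let `x` lie within HALF the radii of `y`, blockwise.  Then
`‖Φ x − Φ y‖ ≤ Σ_i (2M/ϱ i)·‖x i − y i‖`: along the staircase `mix x y 0 = y, …, mix x y n = x` each step moves one
block `i` inside its closed disc of radius `ϱ i`, where the one-variable estimate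
`Dimock2015.norm_sub_le_of_closedBall_subset_half` (Cauchy's formula on the complex line through the block) costs
`(2M/ϱ i)‖x i − y i‖`.  A block read by `Φ` with sensitivity `w` (i.e. `Φ` depends on it through `w •` a bounded map)
has radius `∝ 1/w` — this is how per-block damping factors enter §3. [folklore] -/
theorem norm_sub_le_sum_of_polydisc [CompleteSpace F] {n : ℕ} {Φ : (Fin n → P) → F} {x y : Fin n → P}
    {ϱ : Fin n → ℝ} {M : ℝ} (hϱ : ∀ i, 0 < ϱ i) (hΦ : DifferentiableOn ℂ Φ (polydisc y ϱ))
    (hM : ∀ z ∈ polydisc y ϱ, ‖Φ z‖ ≤ M) (hx : ∀ i, ‖x i - y i‖ ≤ ϱ i / 2) :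
    ‖Φ x - Φ y‖ ≤ ∑ i, 2 * M / ϱ i * ‖x i - y i‖ := by
  -- the summands, extended by zero to all natural indices
  set a : ℕ → ℝ := fun i => if h : i < n then 2 * M / ϱ ⟨i, h⟩ * ‖x ⟨i, h⟩ - y ⟨i, h⟩‖ else 0 with ha
  have hsum : ∑ i : Fin n, 2 * M / ϱ i * ‖x i - y i‖ = ∑ i ∈ range n, a i := by
    rw [← Fin.sum_univ_eq_sum_range]
    refine Finset.sum_congr rfl fun i _ => ?_
    simp [ha, i.isLt]
  have hx' : ∀ i, ‖x i - y i‖ ≤ ϱ i := fun i => (hx i).trans (by linarith [hϱ i])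
  -- the staircase estimate
  have key : ∀ m : ℕ, m ≤ n → ‖Φ (mix x y m) - Φ y‖ ≤ ∑ i ∈ range m, a i := by
    intro m
    induction m with
    | zero =>
        intro _
        simp [mix_zero]
    | succ m ih =>
        intro hm
        have hm' : m < n := Nat.lt_of_succ_le hm
        set μ : Fin n := ⟨m, hm'⟩ with hμ
        have hstep : ‖Φ (mix x y (m + 1)) - Φ (mix x y m)‖ ≤ a m := by
          set z : Fin n → P := mix x y m with hz
          have hzpoly : z ∈ polydisc y ϱ := mix_mem_polydisc (fun i => (hϱ i).le) hx' m
          have hmaps : MapsTo (fun w : P => Function.update z μ w) (closedBall (y μ) (ϱ μ)) (polydisc y ϱ) := by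
            intro w hw
            rw [mem_closedBall, dist_eq_norm] at hw
            exact update_mem_polydisc hzpoly μ hw
          have hgd : DifferentiableOn ℂ (fun w : P => Φ (Function.update z μ w)) (closedBall (y μ) (ϱ μ)) := by
            refine hΦ.comp ?_ hmaps
            intro w _
            exact (hasFDerivAt_update z w).differentiableAt.differentiableWithinAt
          have hgM : ∀ w ∈ closedBall (y μ) (ϱ μ), ‖Φ (Function.update z μ w)‖ ≤ M :=
            fun w hw => hM _ (hmaps hw)
          have h := norm_sub_le_of_closedBall_subset_half (g := fun w : P => Φ (Function.update z μ w))
            (hϱ μ) hgd hgM subset_rfl (hx μ)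
          have e1 : Φ (Function.update z μ (x μ)) = Φ (mix x y (m + 1)) := by
            rw [hz, ← mix_succ x y μ]
          have e2 : Φ (Function.update z μ (y μ)) = Φ (mix x y m) := by
            rw [hz, update_mix_self x y μ]
          have e3 : a m = 2 * M / ϱ μ * ‖x μ - y μ‖ := by
            simp [ha, hm', hμ]
          rw [e3, ← e1, ← e2]
          exact h
        calc ‖Φ (mix x y (m + 1)) - Φ y‖
            ≤ ‖Φ (mix x y (m + 1)) - Φ (mix x y m)‖ + ‖Φ (mix x y m) - Φ y‖ :=
              norm_sub_le_norm_sub_add_norm_sub _ _ _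
          _ ≤ a m + ∑ i ∈ range m, a i := add_le_add hstep (ih hm'.le)
          _ = ∑ i ∈ range (m + 1), a i := by rw [Finset.sum_range_succ, add_comm]
  have hfin := key n le_rfl
  rw [mix_self] at hfin
  rw [hsum]
  exact hfin

end CauchyRate

/-! ## §2 NE5 by scales: the slice shape, the recursive block budget, and its geometric closure -/

section Carrier

variable {C : Carriers}

/-- The two-run output discrepancy at (g, U, X): `|E^A(g, transport U, X) − E^B(g, U, X)|` (the quantity NE5 bounds).
[folklore] -/
def disc (EA : Functional C C.BgA) (EB : Functional C C.BgB) (g : ℕ → ℝ) (U : C.BgB) (X : C.Dom) : ℝ :=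
  |EA g (C.transport U) X - EB g U X|

/-- The discrepancy is nonnegative. [folklore] -/
theorem disc_nonneg (EA : Functional C C.BgA) (EB : Functional C C.BgB) (g : ℕ → ℝ) (U : C.BgB) (X : C.Dom) :
    0 ≤ disc EA EB g U X := abs_nonneg _

/-- HYPOTHESIS SHAPE (NOT PRINTED): the scale-`j` SLICE of NE5 with constant `D` — on the window `W`, for every background and
every domain created at step `j`, `disc ≤ D·e^{−κ d(X)}`. [folklore] -/
def BoundedAtScale (EA : Functional C C.BgA) (EB : Functional C C.BgB) (W : Set (ℕ → ℝ)) (κ : ℝ) (j : ℕ) (D : ℝ) :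
    Prop :=
  ∀ g ∈ W, ∀ (U : C.BgB) (X : C.Dom), C.scale X = j → disc EA EB g U X ≤ D * Real.exp (-(κ * C.d X))

/-- A larger constant is still a bound. [folklore] -/
theorem boundedAtScale_mono {EA : Functional C C.BgA} {EB : Functional C C.BgB} {W : Set (ℕ → ℝ)} {κ : ℝ} {j : ℕ}
    {D D' : ℝ} (h : BoundedAtScale EA EB W κ j D) (hD : D ≤ D') : BoundedAtScale EA EB W κ j D' :=
  fun g hg U X hX => (h g hg U X hX).trans (mul_le_mul_of_nonneg_right hD (Real.exp_pos _).le)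

/-- NE5 with rate θ and constant C₅ is exactly the family of slices with constants `C₅θ^j`. [folklore] -/
theorem ne5_iff_boundedAtScale {EA : Functional C C.BgA} {EB : Functional C C.BgB} {W : Set (ℕ → ℝ)} {κ θ C₅ : ℝ} :
    NE5 EA EB W κ θ C₅ ↔ ∀ j, BoundedAtScale EA EB W κ j (C₅ * θ ^ j) := by
  constructor
  · intro h j g hg U X hX
    have := h g hg U X
    rw [hX] at this
    exact this
  · intro h g hg U X
    exact h (C.scale X) g hg U X rfl

/-- HYPOTHESIS SHAPE (NOT PRINTED): the RECURSIVE BLOCK BUDGET with artifact rate `θ`, history damping `ω`, operator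
constant `A` and history constant `b` — at every scale `k`, whatever nonnegative constants `D_j` bound the discrepancies at
the earlier scales `j < k`, the scale-`k` discrepancy is `≤ (Aθ^k + Σ_{j<k} bω^{k−j}D_j)·e^{−κd(X)}` (operator blocks:
sensitivity × NE3 discrepancy; history block j: damped sensitivity `bω^{k−j}` × inherited discrepancy `D_j`).  The
exponent `k − j` is natural-number subtraction UNDER `j < k` (`j ∈ range k`), so it is the true age `≥ 1`. [folklore] -/
def RecursiveRate (EA : Functional C C.BgA) (EB : Functional C C.BgB) (W : Set (ℕ → ℝ)) (κ θ ω A b : ℝ) : Prop :=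
  ∀ (k : ℕ) (D : ℕ → ℝ), (∀ j < k, 0 ≤ D j ∧ BoundedAtScale EA EB W κ j (D j)) →
    BoundedAtScale EA EB W κ k (A * θ ^ k + ∑ j ∈ range k, b * ω ^ (k - j) * D j)

/-- **GEOMETRIC CLOSURE OF THE RECURSIVE BUDGET** (the NE5-IND step of the cell record; the constant and the smallness are
those of `T4BetaMemory.renewal_geometric`).  If the recursive block budget holds with `0 ≤ A, b, ω` and the SMALLNESS
`(1 + b)ω < θ` (history damping strictly faster than the artifact rate, with room for the history constant), then NE5 holds
with rate θ and the SCALE-UNIFORM constant `C₅ = A(θ − ω)/(θ − (1 + b)ω)`.  Without a contracting memory no uniform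
constant follows (`T4BetaMemory.constMemory_witness`). [folklore] -/
theorem ne5_of_recursiveRate {EA : Functional C C.BgA} {EB : Functional C C.BgB} {W : Set (ℕ → ℝ)}
    {κ θ ω A b : ℝ} (hA : 0 ≤ A) (hb : 0 ≤ b) (hω : 0 ≤ ω) (hsmall : (1 + b) * ω < θ)
    (h : RecursiveRate EA EB W κ θ ω A b) :
    NE5 EA EB W κ θ (A * (θ - ω) / (θ - (1 + b) * ω)) := by
  have hωθ : ω < θ := by nlinarith
  have hθω : 0 < θ - ω := sub_pos.mpr hωθ
  have hden : 0 < θ - (1 + b) * ω := sub_pos.mpr hsmall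
  have hθ : 0 ≤ θ := (hω.trans_lt hωθ).le
  set C₅ := A * (θ - ω) / (θ - (1 + b) * ω) with hC₅
  have hC₅0 : 0 ≤ C₅ := div_nonneg (mul_nonneg hA hθω.le) hden.le
  -- the fixed-point identity of the constant
  have hd : θ - (1 + b) * ω ≠ 0 := hden.ne'
  have he : θ - ω ≠ 0 := hθω.ne'
  have hfix : A + b * C₅ * (ω / (θ - ω)) = C₅ := by
    have ht : (θ - (1 + b) * ω) * (θ - (1 + b) * ω)⁻¹ = 1 := mul_inv_cancel₀ hd
    have hu : (θ - ω) * (θ - ω)⁻¹ = 1 := mul_inv_cancel₀ he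
    rw [hC₅]
    simp only [div_eq_mul_inv]
    linear_combination (A * b * ω * (θ - (1 + b) * ω)⁻¹) * hu + (-A) * ht
  rw [ne5_iff_boundedAtScale]
  intro j
  induction j using Nat.strong_induction_on with
  | _ k ih =>
    have hyp : ∀ j < k, 0 ≤ C₅ * θ ^ j ∧ BoundedAtScale EA EB W κ j (C₅ * θ ^ j) :=
      fun j hj => ⟨mul_nonneg hC₅0 (pow_nonneg hθ j), ih j hj⟩
    have hk := h k (fun j => C₅ * θ ^ j) hyp
    refine boundedAtScale_mono hk ?_
    have hrow : ∑ j ∈ range k, b * ω ^ (k - j) * (C₅ * θ ^ j)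
        = b * C₅ * ∑ j ∈ range k, ω ^ (k - j) * θ ^ j := by
      rw [Finset.mul_sum]
      exact Finset.sum_congr rfl fun j _ => by ring
    have hgeom := geom_row_sum hω hωθ k
    calc A * θ ^ k + ∑ j ∈ range k, b * ω ^ (k - j) * (C₅ * θ ^ j)
        = A * θ ^ k + b * C₅ * ∑ j ∈ range k, ω ^ (k - j) * θ ^ j := by rw [hrow]
      _ ≤ A * θ ^ k + b * C₅ * (ω / (θ - ω) * θ ^ k) := by
          have := mul_le_mul_of_nonneg_left hgeom (mul_nonneg hb hC₅0)
          linarith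
      _ = (A + b * C₅ * (ω / (θ - ω))) * θ ^ k := by ring
      _ = C₅ * θ ^ k := by rw [hfix]

/-- Reading the budget at a slower artifact rate: if the recursive budget holds with rate `θ` and `0 ≤ θ ≤ θ′`, it holds
with rate `θ′` (same `ω, A, b`) — the bookkeeping of the [I]/[III] dichotomy (a geometric loss `ν^{−k}` in the operator
blocks' radii turns sources `Aθ^k` into `A(θ/ν)^k`) and of choosing any admissible `θ′ ∈ ((1 + b)ω, 1]`. [folklore] -/
theorem recursiveRate_mono_rate {EA : Functional C C.BgA} {EB : Functional C C.BgB} {W : Set (ℕ → ℝ)}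
    {κ θ θ' ω A b : ℝ} (hA : 0 ≤ A) (hθ : 0 ≤ θ) (hθθ' : θ ≤ θ') (h : RecursiveRate EA EB W κ θ ω A b) :
    RecursiveRate EA EB W κ θ' ω A b := by
  intro k D hD
  refine boundedAtScale_mono (h k D hD) ?_
  have : A * θ ^ k ≤ A * θ' ^ k := mul_le_mul_of_nonneg_left (pow_le_pow_left₀ hθ hθθ' k) hA
  linarith

/-! ## §3 The per-domain block model (the typed form of the technique) and the reduction NE5 ⇐ block model -/

/-- HYPOTHESIS SHAPE (NOT PRINTED — the typed form of the seat's technique, every field a located missing inequality of the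
cell record `t4/T4-EST-NE5-P1.md`): the PER-DOMAIN CAUCHY BLOCK MODEL over a complex normed input-block space `P`.  For
every scale `k`, every nonnegative vector `D` of bounds at the scales `j < k`, every `g ∈ W`, background `U` and domain `X`
created at step `k`, there are: `m` operator blocks and `k` history blocks (index `Fin (m + k)`, operator blocks first via
`Fin.castAdd`, history block of birth scale `j` at `Fin.natAdd m j`), ONE functional `Φ` complex differentiable on the
closed polydisc of polyradius `ϱ > 0` about run B's data `pB` and bounded by `M` there (B13's (2.41) UNIFORM over the input
tube — G-ne5p1-1), run A's data `pA` within half the radii, the output discrepancy `E^A − E^B = Re(Φ pA − Φ pB)` (one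
functional, two data points — (2.13) p. 14 with (1.5) p. 3), the operator budget `Σ_{i<m}(2M/ϱ_i)‖pA_i − pB_i‖ ≤
Aθ^k e^{−κd(X)}` (MI-1 ⊗ MI-2: NE3 discrepancies over radii) and, for each earlier scale `j`, the history budget
`(2M/ϱ_{m+j})‖pA_{m+j} − pB_{m+j}‖ ≤ bω^{k−j}D_j e^{−κd(X)}` (MI-3: inherited discrepancy `≤ D_j` in the weighted sup norm
over the COMPLEX space, damped sensitivity `bω^{k−j}` from irrelevance). [folklore] -/
def CauchyBlockStep (P : Type*) [NormedAddCommGroup P] [NormedSpace ℂ P] (EA : Functional C C.BgA)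
    (EB : Functional C C.BgB) (W : Set (ℕ → ℝ)) (κ θ ω A b : ℝ) : Prop :=
  ∀ (k : ℕ) (D : ℕ → ℝ), (∀ j < k, 0 ≤ D j ∧ BoundedAtScale EA EB W κ j (D j)) →
    ∀ g ∈ W, ∀ (U : C.BgB) (X : C.Dom), C.scale X = k →
      ∃ (m : ℕ) (Φ : (Fin (m + k) → P) → ℂ) (pA pB : Fin (m + k) → P) (ϱ : Fin (m + k) → ℝ) (M : ℝ),
        (∀ i, 0 < ϱ i) ∧ DifferentiableOn ℂ Φ (polydisc pB ϱ) ∧ (∀ z ∈ polydisc pB ϱ, ‖Φ z‖ ≤ M) ∧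
        (∀ i, ‖pA i - pB i‖ ≤ ϱ i / 2) ∧
        EA g (C.transport U) X - EB g U X = (Φ pA - Φ pB).re ∧
        (∑ i : Fin m, 2 * M / ϱ (Fin.castAdd k i) * ‖pA (Fin.castAdd k i) - pB (Fin.castAdd k i)‖
            ≤ A * θ ^ k * Real.exp (-(κ * C.d X))) ∧
        (∀ j : Fin k, 2 * M / ϱ (Fin.natAdd m j) * ‖pA (Fin.natAdd m j) - pB (Fin.natAdd m j)‖
            ≤ b * ω ^ (k - (j : ℕ)) * D j * Real.exp (-(κ * C.d X)))

/-- **THE BLOCK MODEL GIVES THE RECURSIVE BUDGET**: by the per-block Cauchy rate (§1, with `F = ℂ`), `|Re w| ≤ ‖w‖`, and the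
splitting `Fin.sum_univ_add` of the block sum into operator and history parts. [folklore] -/
theorem recursiveRate_of_cauchyBlockStep {P : Type*} [NormedAddCommGroup P] [NormedSpace ℂ P]
    {EA : Functional C C.BgA} {EB : Functional C C.BgB} {W : Set (ℕ → ℝ)} {κ θ ω A b : ℝ}
    (h : CauchyBlockStep P EA EB W κ θ ω A b) : RecursiveRate EA EB W κ θ ω A b := by
  intro k D hD g hg U X hX
  obtain ⟨m, Φ, pA, pB, ϱ, M, hϱ, hΦ, hM, hclose, hval, hop, hhist⟩ := h k D hD g hg U X hX
  have hcauchy := norm_sub_le_sum_of_polydisc hϱ hΦ hM hclose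
  rw [Fin.sum_univ_add] at hcauchy
  have hhist' : ∑ j : Fin k, 2 * M / ϱ (Fin.natAdd m j) * ‖pA (Fin.natAdd m j) - pB (Fin.natAdd m j)‖
      ≤ ∑ j : Fin k, b * ω ^ (k - (j : ℕ)) * D j * Real.exp (-(κ * C.d X)) :=
    Finset.sum_le_sum fun j _ => hhist j
  have hrange : ∑ j : Fin k, b * ω ^ (k - (j : ℕ)) * D j * Real.exp (-(κ * C.d X))
      = (∑ j ∈ range k, b * ω ^ (k - j) * D j) * Real.exp (-(κ * C.d X)) := by
    rw [Finset.sum_mul]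
    exact Fin.sum_univ_eq_sum_range (fun j => b * ω ^ (k - j) * D j * Real.exp (-(κ * C.d X))) k
  unfold disc
  rw [hval]
  calc |(Φ pA - Φ pB).re| ≤ ‖Φ pA - Φ pB‖ := Complex.abs_re_le_norm _
    _ ≤ _ := hcauchy
    _ ≤ A * θ ^ k * Real.exp (-(κ * C.d X)) + (∑ j ∈ range k, b * ω ^ (k - j) * D j) * Real.exp (-(κ * C.d X)) := by
        rw [← hrange]
        exact add_le_add hop hhist'
    _ = (A * θ ^ k + ∑ j ∈ range k, b * ω ^ (k - j) * D j) * Real.exp (-(κ * C.d X)) := by ring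

/-- **NE5 FROM THE BLOCK MODEL** (the seat's reduction, kernel-checked end to end): the per-domain Cauchy block model with
`0 ≤ A, b, ω` and `(1 + b)ω < θ` yields `NE5 EA EB W κ θ (A(θ − ω)/(θ − (1 + b)ω))`.  Everything non-trivial about
Bałaban's functionals is in the HYPOTHESIS `CauchyBlockStep` (located, not proved). [folklore] -/
theorem ne5_of_cauchyBlockStep {P : Type*} [NormedAddCommGroup P] [NormedSpace ℂ P]
    {EA : Functional C C.BgA} {EB : Functional C C.BgB} {W : Set (ℕ → ℝ)} {κ θ ω A b : ℝ}
    (hA : 0 ≤ A) (hb : 0 ≤ b) (hω : 0 ≤ ω) (hsmall : (1 + b) * ω < θ)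
    (h : CauchyBlockStep P EA EB W κ θ ω A b) :
    NE5 EA EB W κ θ (A * (θ - ω) / (θ - (1 + b) * ω)) :=
  ne5_of_recursiveRate hA hb hω hsmall (recursiveRate_of_cauchyBlockStep h)

end Carrier

/-! ## §4 Non-vacuity: a toy carrier on which the block model holds and the chain produces a true NE5 -/

section Toy

/-- Toy carriers: domains = creation steps, no tree length, trivial backgrounds. [folklore] -/
def toyCarriers : Carriers where
  Dom := ℕ
  scale := fun k => k
  d := fun _ => 0
  d_nonneg := fun _ => le_rfl
  BgA := Unit
  BgB := Unit
  gauge := fun _ _ => 0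
  gauge_nonneg := fun _ _ => le_rfl
  transport := fun u => u

/-- Toy run A: output `(1/2)^k` at a domain created at step `k`. [folklore] -/
def toyEA : Functional toyCarriers toyCarriers.BgA := fun _ _ X => (1 / 2 : ℝ) ^ toyCarriers.scale X

/-- Toy run B: output `0`. [folklore] -/
def toyEB : Functional toyCarriers toyCarriers.BgB := fun _ _ _ => 0

/-- The toy pair satisfies the Cauchy block model with `P = ℂ`, one operator block (the linear functional "read block 0",
data `(1/2)^k` versus `0`, radius 2, bound 2), all history data equal, `θ = 1/2`, `ω = 1/8`, `A = 2`, `b = 1`.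
[folklore] -/
theorem toy_cauchyBlockStep :
    CauchyBlockStep ℂ toyEA toyEB (Set.univ : Set (ℕ → ℝ)) 0 (1 / 2) (1 / 8) 2 1 := by
  intro k D hD g _ U X hX
  have hhalf : (0 : ℝ) ≤ 1 / 2 := by norm_num
  have hnorm : ‖(((1 / 2 : ℝ) ^ k : ℝ) : ℂ)‖ = (1 / 2 : ℝ) ^ k := by
    rw [Complex.norm_real, Real.norm_eq_abs, abs_of_nonneg (pow_nonneg hhalf k)]
  have hdX : toyCarriers.d X = 0 := rfl
  -- one operator block carrying the whole discrepancy, k history blocks carrying none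
  refine ⟨1, fun z => z (Fin.castAdd k 0), fun i => if i = Fin.castAdd k 0 then (((1 / 2 : ℝ) ^ k : ℝ) : ℂ) else 0,
    fun _ => 0, fun _ => 2, 2, fun _ => by norm_num, ?_, ?_, ?_, ?_, ?_, ?_⟩
  · -- a coordinate projection is differentiable
    exact (differentiable_apply (𝕜 := ℂ) (Fin.castAdd k (0 : Fin 1))).differentiableOn
  · intro z hz
    simpa using hz (Fin.castAdd k 0)
  · intro i
    by_cases hi : i = Fin.castAdd k 0
    · subst hi
      have h1 : ((1 / 2 : ℝ) ^ k) ≤ 1 := pow_le_one₀ hhalf (by norm_num)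
      simp only [if_true, sub_zero]
      rw [hnorm]
      linarith
    · simp [hi]
  · -- the real output discrepancy is the real part of Φ pA − Φ pB
    simp only [toyEA, toyEB, hX, if_true, sub_zero]
    exact (Complex.ofReal_re _).symm
  · -- operator budget: (2·2/2)·(1/2)^k ≤ 2·(1/2)^k·e^0
    simp only [Fin.sum_univ_one, if_true, sub_zero, hdX, mul_zero, neg_zero, Real.exp_zero, mul_one]
    rw [hnorm]
    have : (0 : ℝ) ≤ (1 / 2 : ℝ) ^ k := pow_nonneg hhalf k
    nlinarith
  · -- history budget: the history blocks agree, and the right-hand side is nonnegative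
    intro j
    have hne : Fin.natAdd 1 j ≠ Fin.castAdd k (0 : Fin 1) := by
      intro e
      have := congrArg Fin.val e
      simp at this
    simp only [hne, if_false, sub_self, norm_zero, mul_zero, hdX, neg_zero, Real.exp_zero, mul_one]
    have hDj : 0 ≤ D j := (hD j j.isLt).1
    positivity

/-- Hence, by `ne5_of_cauchyBlockStep`, the toy pair satisfies NE5 with rate `1/2` and the constant
`2(1/2 − 1/8)/(1/2 − 2/8) = 3`: the hypotheses of the chain are jointly satisfiable and the conclusion is a true
statement (`(1/2)^k ≤ 3·(1/2)^k`). [folklore] -/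
theorem toy_ne5 :
    NE5 toyEA toyEB (Set.univ : Set (ℕ → ℝ)) 0 (1 / 2) (2 * (1 / 2 - 1 / 8) / (1 / 2 - (1 + 1) * (1 / 8))) :=
  ne5_of_cauchyBlockStep (P := ℂ) (by norm_num) (by norm_num) (by norm_num) (by norm_num) toy_cauchyBlockStep

end Toy

end Literature.MathematicalPhysics.QuantumFieldTheory.Balaban1983to89.T4InputCauchyRate

end
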